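import Summits.QuantumFields.QCD.Theses.NestedDissectionSea
import Summits.QuantumFields.QCD.Theorems.EarlyCrosserLaw.Negative.CellPositivityDomain
import Literature.MathematicalPhysics.QuantumFieldTheory.QCDPhaseQuenched
import Mathlib

/-!
# Stub `stub_crossingCharge` of line `accretive-coarse-jensen`
(crux `Summit.QuantumFields.QCD.Theses.NestedDissectionSea.EarlyCrosserLaw`,
item stmt-QuantumFields-13995)

## What is proved

Let `M := wilsonCell U 0 x s` be the massless Dirichlet cell matrix of the box `(x, s)` (an
`n × n` complex matrix) and `p := M.charpoly`.  For a centre `c : ℝ` and a radius `ρ` write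
`A(ρ) := Real.circleAverage (fun z ↦ Real.log ‖p.eval z‖) c ρ` for the circle average of
`log |p|`.  The registered stub `stub_crossingCharge` is the deterministic *two-circle Jensen
charge* of a real-eigenvalue crossing: if the cell at bare mass `μ'` is singular,
`det (wilsonCell U μ' x s) = 0`, and `|μ' + c| ≤ r < R`, then

  `log (R / r) ≤ A(R) - A(r)`.

## Proof route

* The bare mass enters the cell matrix additively on the diagonal:
  `wilsonCell U μ' x s = wilsonCell U 0 x s + μ' • 1` (`crossingCharge_wilsonCell_eq_add_smul_one`),
  so a singular cell at mass `μ'` means that `-μ'` is a root of `p`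
  (`crossingCharge_charpoly_eval_neg_mass`, via `Matrix.eval_charpoly`).
* Root form of the circle average (`crossingCharge_circleAverage_log_norm_prod`): for every
  multiset `T` of complex numbers and every `ρ ≠ 0`,
  `circleAverage (log ‖∏_{u ∈ T} (· - u)‖) c ρ = ∑_{u ∈ T} (log ρ + log⁺ (ρ⁻¹ ‖c - u‖))`,
  by induction on `T` from Mathlib's `circleAverage_log_norm_sub_const_eq_log_radius_add_posLog`
  (the functions `log ‖(z - u) P(z)‖` and `log ‖z - u‖ + log ‖P z‖` agree off the finite root
  set, which is codiscrete on the circle).  Since `p` is monic and splits over `ℂ`,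
  `p.eval z = ∏_{u ∈ p.roots} (z - u)` and the root form applies (`…_log_norm_eval`).
* Per-root kernel: `g(d) := (log R + log⁺ (d / R)) - (log r + log⁺ (d / r))` is non-negative for
  `0 < r < R`, `0 ≤ d` (`crossingCharge_kernel_nonneg`) and equals `log (R / r)` when `d ≤ r`
  (`crossingCharge_kernel_eq`).  The root `-μ'` has `‖c - (-μ')‖ = |μ' + c| ≤ r`, so its term is
  `log (R / r)` and all other terms are `≥ 0`.

Sources: Jensen's formula for polynomials (folklore); Mathlib
`Mathlib/Analysis/SpecialFunctions/Integrals/PosLogEqCircleAverage.lean`.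
-/

noncomputable section

open scoped BigOperators Matrix ComplexConjugate
open Filter MeasureTheory
open Literature.MathematicalPhysics.QuantumLattice Literature.MathematicalPhysics.QuantumFieldTheory
  Literature.Probability.LatticeModels
open Summit.QuantumFields.QCD.Theses.NestedDissectionSea

namespace Summit.QuantumFields.QCD.Cruxes.EarlyCrosserLaw.AccretiveCoarseJensen

/-- Local notation: the colour group `SU(3)`. -/
local notation "𝔾" => Matrix.specialUnitaryGroup (Fin 3) ℂ

/-! ### Step 1: the bare mass is an additive diagonal shift of the cell matrix -/

/-- The bare mass enters the Dirichlet cell matrix additively on the diagonal: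
`D_c(μ) = D_c(0) + μ • 1`. -/
theorem crossingCharge_wilsonCell_eq_add_smul_one {N : ℕ} [NeZero N] (U : GaugeConfig 4 N 𝔾)
    (μ : ℝ) (x : TorusSite 4 N) (s : Fin 4 → ℕ) :
    wilsonCell U μ x s = wilsonCell U 0 x s + ((μ : ℝ) : ℂ) • (1 : Matrix _ _ ℂ) := by
  ext p q
  rw [Matrix.add_apply, Matrix.smul_apply, Matrix.one_apply, smul_eq_mul]
  simp only [wilsonCell, Matrix.toSquareBlockProp_def, Matrix.of_apply, wilsonDirac]
  by_cases h : p = q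
  · have h' : (p : TorusSite 4 N × Fin 3 × Fin 4) = q := congrArg Subtype.val h
    rw [if_pos h', if_pos h', if_pos h]
    push_cast
    ring
  · have h' : (p : TorusSite 4 N × Fin 3 × Fin 4) ≠ q := fun h'' => h (Subtype.ext h'')
    rw [if_neg h', if_neg h', if_neg h]
    ring

/-! ### Step 2: a singular cell at mass `μ'` is a root `-μ'` of the massless characteristic
polynomial -/

/-- If the cell at bare mass `μ'` is singular, then `-μ'` is a root of the characteristic
polynomial of the massless cell matrix. -/
theorem crossingCharge_charpoly_eval_neg_mass {N : ℕ} [NeZero N] (U : GaugeConfig 4 N 𝔾)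
    (μ' : ℝ) (x : TorusSite 4 N) (s : Fin 4 → ℕ) (hdet : (wilsonCell U μ' x s).det = 0) :
    ((wilsonCell U 0 x s).charpoly).eval (-((μ' : ℝ) : ℂ)) = 0 := by
  rw [Matrix.eval_charpoly]
  have key : Matrix.scalar _ (-((μ' : ℝ) : ℂ)) - wilsonCell U 0 x s = -wilsonCell U μ' x s := by
    rw [crossingCharge_wilsonCell_eq_add_smul_one U μ' x s]
    ext i j
    simp only [Matrix.scalar_apply, Matrix.sub_apply, Matrix.diagonal_apply, Matrix.neg_apply,
      Matrix.add_apply, Matrix.smul_apply, Matrix.one_apply, smul_eq_mul]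
    split_ifs <;> ring
  rw [key, Matrix.det_neg, hdet, mul_zero]

/-! ### Step 3: root form of the circle average of `log ‖∏ (z - u)‖` -/

/-- The product `z ↦ ∏_{u ∈ T} (z - u)` over a multiset `T` is an entire function. -/
theorem crossingCharge_analyticOnNhd_prod (T : Multiset ℂ) :
    AnalyticOnNhd ℂ (fun z : ℂ => (T.map (fun u => z - u)).prod) Set.univ := by
  induction T using Multiset.induction_on with
  | empty =>
    simp only [Multiset.map_zero, Multiset.prod_zero]
    exact analyticOnNhd_const
  | cons u T ih =>
    simp only [Multiset.map_cons, Multiset.prod_cons]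
    exact (analyticOnNhd_id.sub analyticOnNhd_const).mul ih

/-- **Root form of the circle average (Jensen's formula for a product of linear factors).**
For every multiset `T` of complex numbers, every centre `c` and every radius `ρ ≠ 0`,
`circleAverage (log ‖∏_{u ∈ T} (· - u)‖) c ρ = ∑_{u ∈ T} (log ρ + log⁺ (ρ⁻¹ * ‖c - u‖))`. -/
theorem crossingCharge_circleAverage_log_norm_prod (c : ℂ) {ρ : ℝ} (hρ : ρ ≠ 0)
    (T : Multiset ℂ) :
    Real.circleAverage (fun z : ℂ => Real.log ‖(T.map (fun u => z - u)).prod‖) c ρ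
      = (T.map fun u => Real.log ρ + Real.posLog (ρ⁻¹ * ‖c - u‖)).sum := by
  induction T using Multiset.induction_on with
  | empty => simp [Real.circleAverage_const]
  | cons u T ih =>
    simp only [Multiset.map_cons, Multiset.prod_cons, Multiset.sum_cons]
    have hcod : (fun z : ℂ => Real.log ‖(z - u) * (T.map (fun v => z - v)).prod‖)
        =ᶠ[Filter.codiscreteWithin (Metric.sphere c |ρ|)]
        ((fun z : ℂ => Real.log ‖z - u‖)
          + fun z : ℂ => Real.log ‖(T.map (fun v => z - v)).prod‖) := by
      filter_upwards [compl_finite_mem_codiscreteWithin (Multiset.finite_toSet (u ::ₘ T))]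
        with z hz
      simp only [Set.mem_compl_iff, Set.mem_setOf_eq, Multiset.mem_cons, not_or] at hz
      have hzu : z - u ≠ 0 := sub_ne_zero.2 hz.1
      have hzT : (T.map (fun v => z - v)).prod ≠ 0 := by
        rw [Ne, Multiset.prod_eq_zero_iff, Multiset.mem_map]
        rintro ⟨v, hv, hv0⟩
        rw [sub_eq_zero] at hv0
        exact hz.2 (hv0 ▸ hv)
      rw [Pi.add_apply, norm_mul,
        Real.log_mul (norm_ne_zero_iff.2 hzu) (norm_ne_zero_iff.2 hzT)]
    rw [Real.circleAverage_congr_codiscreteWithin hcod hρ,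
      Real.circleAverage_add (circleIntegrable_log_norm_sub_const ρ)
        (((crossingCharge_analyticOnNhd_prod T).mono
          (Set.subset_univ _)).meromorphicOn.circleIntegrable_log_norm),
      ih, circleAverage_log_norm_sub_const_eq_log_radius_add_posLog hρ]

/-- **Root form of the circle average of `log |p|` for a monic complex polynomial `p`:**
`circleAverage (log ‖p.eval ·‖) c ρ = ∑_{u ∈ p.roots} (log ρ + log⁺ (ρ⁻¹ * ‖c - u‖))` for
`ρ ≠ 0` (roots counted with multiplicity). -/
theorem crossingCharge_circleAverage_log_norm_eval {p : Polynomial ℂ} (hp : p.Monic) (c : ℂ)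
    {ρ : ℝ} (hρ : ρ ≠ 0) :
    Real.circleAverage (fun z : ℂ => Real.log ‖p.eval z‖) c ρ
      = (p.roots.map fun u => Real.log ρ + Real.posLog (ρ⁻¹ * ‖c - u‖)).sum := by
  have hfun : (fun z : ℂ => Real.log ‖p.eval z‖)
      = fun z : ℂ => Real.log ‖(p.roots.map (fun u => z - u)).prod‖ := by
    funext z
    rw [(IsAlgClosed.splits p).eval_eq_prod_roots_of_monic hp z]
  rw [hfun, crossingCharge_circleAverage_log_norm_prod c hρ p.roots]

/-! ### Step 4: the per-root kernel -/

/-- For `0 < ρ` and `0 < d`: `log ρ + log⁺ (ρ⁻¹ * d) = max (log ρ) (log d)`. -/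
theorem crossingCharge_log_add_posLog {ρ d : ℝ} (hρ : 0 < ρ) (hd : 0 < d) :
    Real.log ρ + Real.posLog (ρ⁻¹ * d) = max (Real.log ρ) (Real.log d) := by
  rw [Real.posLog_apply, Real.log_mul (inv_ne_zero hρ.ne') hd.ne', Real.log_inv]
  rcases le_total 0 (-Real.log ρ + Real.log d) with h | h
  · rw [max_eq_right h, max_eq_right (by linarith)]
    ring
  · rw [max_eq_left h, max_eq_left (by linarith), add_zero]

/-- The per-root kernel `(log R + log⁺ (d / R)) - (log r + log⁺ (d / r))` is non-negative for
`0 < r < R` and `0 ≤ d`. -/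
theorem crossingCharge_kernel_nonneg {r R d : ℝ} (hr : 0 < r) (hrR : r < R) (hd : 0 ≤ d) :
    0 ≤ (Real.log R + Real.posLog (R⁻¹ * d)) - (Real.log r + Real.posLog (r⁻¹ * d)) := by
  have hR : 0 < R := hr.trans hrR
  rcases hd.eq_or_lt with h0 | hdpos
  · rw [← h0, mul_zero, mul_zero, Real.posLog_zero, add_zero, add_zero, sub_nonneg]
    exact Real.log_le_log hr hrR.le
  · rw [crossingCharge_log_add_posLog hR hdpos, crossingCharge_log_add_posLog hr hdpos, sub_nonneg]
    exact max_le_max_right _ (Real.log_le_log hr hrR.le)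

/-- The per-root kernel `(log R + log⁺ (d / R)) - (log r + log⁺ (d / r))` equals `log (R / r)`
for a root at distance `d ≤ r` from the centre (`0 < r < R`). -/
theorem crossingCharge_kernel_eq {r R d : ℝ} (hr : 0 < r) (hrR : r < R) (hd : 0 ≤ d)
    (hdr : d ≤ r) :
    (Real.log R + Real.posLog (R⁻¹ * d)) - (Real.log r + Real.posLog (r⁻¹ * d))
      = Real.log (R / r) := by
  have hR : 0 < R := hr.trans hrR
  have h1 : Real.posLog (R⁻¹ * d) = 0 := by
    rw [Real.posLog_eq_zero_iff, abs_of_nonneg (by positivity), inv_mul_le_iff₀ hR]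
    linarith
  have h2 : Real.posLog (r⁻¹ * d) = 0 := by
    rw [Real.posLog_eq_zero_iff, abs_of_nonneg (by positivity), inv_mul_le_iff₀ hr]
    linarith
  rw [h1, h2, Real.log_div hR.ne' hr.ne']
  ring

/-! ### Step 5: the registered stub -/

/-- **Two-circle Jensen charge of a crossing** (registered stub `stub_crossingCharge` of line
`accretive-coarse-jensen`).  If the Dirichlet cell of the box `(x, s)` at bare mass `μ'` is
singular and `|μ' + c| ≤ r < R` (with `0 < r`), then the two-circle Jensen excess of
`log ‖charpoly (wilsonCell U 0 x s)‖` between the circles of radii `r` and `R` about `c` is at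
least `log (R / r)`: the root `-μ'` of the characteristic polynomial lies in the inner disc and
contributes exactly `log (R / r)`, every other root contributes a non-negative amount. -/
theorem stub_crossingCharge :
    ∀ (N : ℕ) [NeZero N] (U : GaugeConfig 4 N 𝔾) (x : TorusSite 4 N) (s : Fin 4 → ℕ)
      (μ' c r R : ℝ), 0 < r → r < R → (wilsonCell U μ' x s).det = 0 → |μ' + c| ≤ r →
      Real.log (R / r) ≤
        Real.circleAverage (fun z : ℂ => Real.log ‖((wilsonCell U 0 x s).charpoly).eval z‖) (c : ℂ) R
          - Real.circleAverage (fun z : ℂ => Real.log ‖((wilsonCell U 0 x s).charpoly).eval z‖) (c : ℂ) r := by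
  intro N _ U x s μ' c r R hr hrR hdet habs
  have hR : 0 < R := hr.trans hrR
  have hmonic : (wilsonCell U 0 x s).charpoly.Monic := Matrix.charpoly_monic _
  rw [crossingCharge_circleAverage_log_norm_eval hmonic (c : ℂ) hR.ne',
    crossingCharge_circleAverage_log_norm_eval hmonic (c : ℂ) hr.ne', ← Multiset.sum_map_sub]
  have hroot : -((μ' : ℝ) : ℂ) ∈ (wilsonCell U 0 x s).charpoly.roots := by
    rw [Polynomial.mem_roots hmonic.ne_zero, Polynomial.IsRoot.def]
    exact crossingCharge_charpoly_eval_neg_mass U μ' x s hdet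
  have hnorm : ‖(c : ℂ) - -((μ' : ℝ) : ℂ)‖ ≤ r := by
    rw [sub_neg_eq_add, ← Complex.ofReal_add, Complex.norm_real, Real.norm_eq_abs, add_comm]
    exact habs
  rw [← Multiset.cons_erase hroot, Multiset.map_cons, Multiset.sum_cons,
    crossingCharge_kernel_eq hr hrR (norm_nonneg _) hnorm]
  have hrest : 0 ≤ (((wilsonCell U 0 x s).charpoly.roots.erase (-((μ' : ℝ) : ℂ))).map
      fun u => (Real.log R + Real.posLog (R⁻¹ * ‖(c : ℂ) - u‖))
        - (Real.log r + Real.posLog (r⁻¹ * ‖(c : ℂ) - u‖))).sum := by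
    apply Multiset.sum_nonneg
    intro t ht
    rw [Multiset.mem_map] at ht
    obtain ⟨u, -, rfl⟩ := ht
    exact crossingCharge_kernel_nonneg hr hrR (norm_nonneg _)
  linarith

end Summit.QuantumFields.QCD.Cruxes.EarlyCrosserLaw.AccretiveCoarseJensen

end
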